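import Summits.CriticalPhenomena.SAWScalingLimit.Theorems.SAWDevelopingMapInteriorFlatteningLiouvilleNecessity

/-!
# Picture limits are local limits: the sub-route's core (S5) is a special case of the top-layer core (S5\*)

Crux `stmt-CriticalPhenomena-8297` (`Summit.CriticalPhenomena.SAWScalingLimit.Theses.SAWDevelopingMap.InteriorFlattening`),
line `liouville-local-limits`, lead `prover-line-stmt-CriticalPhenomena-8297-c3-0` (cycle 3, reshape r9). The skeleton's
top layer is the necessary-and-sufficient pair {S1 `BulkNoFold`, S5\* `LocalLimitsUnique`} (Equivalence, landed); the
sub-route reaches S5\* from S5 `PictureLimitsUnique` + the two windowed far-field bets S6, S6' (S4 + S7, landed). This file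
records the inclusion that orders the two cores:

  `PicLimits ⊆ LocalLimits`                     (`picLimits_subset_localLimits`, registered sub-goal)

— every picture domain `B_{S_n}(O) ∖ P_n.1` of a good, `n`-clean picture rooted at its dart IS an admissible configuration
of depth `n` (simply connected by goodness, dart a boundary root by `Necessity.picRoot_mem_boundary`, `O` `n`-deep by
`Necessity.deep_picDom`), with the same monopole normalisation (`picMono = obsMono` of that configuration, definitionally).
Hence `LocalLimits.Subsingleton → PicLimits.Subsingleton` and, parameter-wise, S5\* ⟹ S5
(`pictureLimitsUnique_of_localLimitsUnique`): the sub-route's core is implied by the top-layer core, so the sub-route can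
only ever be a way of PROVING S5\*, never a weakening of the crux. Sources: the line card
`Cruxes/InteriorFlattening/Lines/liouville-local-limits.md`; H. Duminil-Copin, S. Smirnov, Ann. of Math. 175 (2012)
(arXiv:1007.0575), §2 (domains, boundary mid-edges).
-/

noncomputable section

open scoped Topology
open Filter Literature.Probability.LatticeModels Literature.Probability.RandomPlanarGeometry.SAW

namespace Summit.CriticalPhenomena.SAWScalingLimit.Theorems.InteriorFlattening.Liouville

/-- **Picture limits are local limits**: `PicLimits ⊆ LocalLimits`. The approximating sequence of a picture
limit — picture domains `latticeBall (S n) ∖ (P n).1` rooted at `picRoot (P n)`, `P n` good and `n`-clean, `n ≤ S n` —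
is a sequence of admissible configurations `Adm n`, its monopoles at `O` are the picture monopoles (non-zero by
hypothesis), and the normalised fields are literally the same functions. -/
theorem picLimits_subset_localLimits : PicLimits ⊆ LocalLimits := by
  intro G hG
  obtain ⟨hoff, S, P, hP, hmono, hlim⟩ := hG
  refine ⟨hoff, fun n => latticeBall (S n) \ (P n).1, fun n => picRoot (P n), fun n => ?_,
    fun n => hmono n, fun z hz => hlim z hz⟩
  exact ⟨(hP n).2.2.1.1, Necessity.picRoot_mem_boundary (hP n).2.1 (hP n).2.2.1,
    Necessity.deep_picDom (hP n).1 (hP n).2.2.2⟩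

/-- Uniqueness of local limits gives uniqueness of picture limits. -/
theorem picLimits_subsingleton_of_localLimits_subsingleton (h : LocalLimits.Subsingleton) :
    PicLimits.Subsingleton :=
  h.anti picLimits_subset_localLimits

/-- **S5\* ⟹ S5** with the same no-fold parameters: the top-layer core `LocalLimitsUnique` of the skeleton
(r9) implies the sub-route's core `PictureLimitsUnique` (both spelled out over the Defs objects). -/
theorem pictureLimitsUnique_of_localLimitsUnique :
    (∀ k R₀ : ℝ, 0 ≤ k → k < 1 → RatioAtDepth R₀ k → LocalLimits.Subsingleton) →
      ∀ k R₀ : ℝ, 0 ≤ k → k < 1 → RatioAtDepth R₀ k → PicLimits.Subsingleton :=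
  fun h k R₀ hk0 hk1 hR => (h k R₀ hk0 hk1 hR).anti picLimits_subset_localLimits

end Summit.CriticalPhenomena.SAWScalingLimit.Theorems.InteriorFlattening.Liouville

end
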